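import Summits.QuantumFields.YangMills.Theorems.BalabanLadderIRLightCodePincer
import Summits.QuantumFields.YangMills.Theorems.BalabanLadderIRLightCodeBlindness
import Summits.QuantumFields.YangMills.Theorems.BalabanLadderIRPinnedExit96
import Summits.QuantumFields.YangMills.Theorems.BalabanLadderIRCofinalCouplingsBridge
import Summits.QuantumFields.YangMills.Theses.BalabanLadder
import HarnessLib

/-!
# Crux `BalabanLadder.IR` (stmt-QuantumFields-19354) — LINE D «rank-purity» (ideator ym-ir-idea-14 gen 4, lens strengthen-to-induct
# applied to the RESIDUAL token `N = IRnsc`): cold purity MODULO A LIGHT MULTIPLET OF RANK `Q`, squared along the scales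

HONESTY.  Nothing here proves the Clay Yang–Mills mass gap, a lattice gap, `IRnsc` or `BalabanLadder.IR`; `R4` closes only the
conditional finite-𝕋⁴ rung `BalabanLadder.UV`.  This file TYPES a finite-box bill for the non-simply-connected half `N = IRnsc` of the
crux (which no §L row of `pub/ym-ir/REDUCTION-CENSUS.md` bills in finite-box currency) and PROVES its seam; the Yang–Mills content sits
in three OPEN stubs `stub_pinnedRankExit` (THE NUMBERᴷ: one rank-`Q`-pure cold box per weak coupling, floor units), `stub_rankTailSquaring`
(Rᴷ: the rank-`Q` tail squares under spatial doubling — a NEW finite-size-scaling conjecture generalising the PROVED rank-0 recursion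
`AspectBootstrap.defectSquaring`, truth unknown) and `stub_blindGivenMultiplet` (BLINDᴷ: the flux-code / sector-blindness property, XL),
plus the shared simply-connected slot of record `stub_pinnedExit96 = PinnedExit96.PinnedExitAt (1/24)`.

THE STRENGTHENING.  For `π₁(G) ≠ 1` the cold periodic torus carries `|π₁(G)|³` asymptotically degenerate 't Hooft flux vacua, so the
rank-0 purity `δᶜ → 1 − |π₁|⁻³` never exits (route negatives `LightFluxMode*`).  S⁺ := «at every weak coupling, on every cold symmetric
torus beyond a floor-pinned size, the normalised transfer spectrum is {vacuum} ∪ {≤ Q light levels} ∪ {a tail of total weight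
≤ (2S+1)³ e^{−(m+2)/ξ(β)}}» = the tree's W-currency `LightMultipletPressureAt r β Q (1/ξ)` PINNED to the floor (`a β · ξ(β) ≤ T`).
S⁺ ⊋ clustering-at-the-floor (it is a statement about ALL cold scales and about the whole spectrum), and it ADMITS INDUCTION ON SCALES:
the inductive quantity is the rank-`Q` tail `rankTail = traceExcess − Σ_{j∈F} r_j^{m+2}` (spectral weight beyond the vacuum and `Q`
removed levels), the inductive step is Rᴷ (squaring under `S ↦ S' ∈ [2S,4S]`), the base is PXᴷ (one box per coupling).

PROVED here (sorry-free): `hasSum_rankTail`, `rankTail_nonneg`, `rankTail_le_exp_of_le` (rank-`Q` propagation in the time extent),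
`rankTail_double_le_sq` (RUNG: the time-doubling half of Rᴷ holds at every rank — `rankTail(2m+2) ≤ rankTail(m)²` on the same torus),
`exists_fin_pad`, the achievable-bound infimum `infTail` with `infTail_recursion`, the SEAM `multipletPinned_of_exit_squaring :
PinnedRankExit → RankTailSquaring → MultipletPinned` (iterate Rᴷ from the PXᴷ box via the generic `DoublingDefect.defect_decay_of_recursion`,
read the tail at every larger cold torus, pad to `Fin Q`), and the compositions BY NAME `irnsc_of_rankPurity : PinnedRankExit →
RankTailSquaring → BlindGivenMultiplet → IRnsc` (via `FluxCodeBlindness.gapInUnits_of_lightCode_pinned`) and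
`IR_of_stubs : … → Theses.BalabanLadder.IR` (via `PinnedExit96.IR_of`).

BILL OF RECORD (R423, director-ym №25, census v4.4): the rung is the cofinal leaf `IRcof` = K1 `ExitsUnboundedAt (1/24)` ∧ X
`AFToColdPressure` ∧ N `IRnsc` (`Cruxes.IR.CofinalLeaf.closes_cof`).  This line bills ONLY the token N, in finite-box currency:
N ⇐ PXᴷ ∧ Rᴷ ∧ BLINDᴷ (`irnsc_of_rankPurity`, seam proved); composed with the slot of record it gives the crux decl
(`IR_of_stubs`, via PX = `PinnedExit96.PinnedExitAt (1/24)`, which also yields K1), and composed with `closes_cof` ∕ idea-11's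
`pinned_exit_cofinal` it discharges the N conjunct of the cofinal bill verbatim (no β-transport ∕ uniform-in-coupling estimate is
used or owed here beyond what N itself states; Rᴷ's premise-restricted basin form is a per-coupling statement with one constant).
-/

set_option autoImplicit false

noncomputable section

open MeasureTheory Filter Topology
open scoped BigOperators SchwartzMap
open Literature.MathematicalPhysics.QuantumFieldTheory Literature.MathematicalPhysics.QuantumLattice
open Summit.QuantumFields.YangMills.Cruxes.OSLegsFromFemtoAndGap.DlrCollarTransfer (GapInUnits LowerBounds)
open Summit.QuantumFields.YangMills.Cruxes.IR.ColdPressurePincer (IRsc IRnsc)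
open Summit.QuantumFields.YangMills.Cruxes.IR.FluxCodeBlindness (LightMultipletPressureAt LightCodeCertificateAt
  gapInUnits_of_lightCode_pinned)
open Summit.QuantumFields.YangMills.Theorems.DoublingDefect (exists_ratios_hasSum_traceExcess defect_decay_of_recursion)

namespace Summit.QuantumFields.YangMills.Cruxes.IR.RankPurity

/-! ## §1 Objects: the canonical cold shape, ratio data, the rank-`Q` tail -/

/-- The minimal cold time exponent of the symmetric torus `(2S+1)³`: `coldExp S + 2 = ⌈(S+1)/2⌉` is the least `m + 2` in the cold
range `S + 1 ≤ 2(m+2)` of `ColdPressureBound` / `LightMultipletPressureAt` (aspect `≈ 4:1`). -/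
def coldExp (S : ℕ) : ℕ := (S - 2) / 2

theorem coldExp_cold (S : ℕ) : S + 1 ≤ 2 * (coldExp S + 2) := by
  unfold coldExp; omega

theorem coldExp_le {S m : ℕ} (h : S + 1 ≤ 2 * (m + 2)) : coldExp S ≤ m := by
  unfold coldExp; omega

theorem coldExp_add_two_le (S : ℕ) : 2 * (coldExp S + 2) ≤ S + 4 := by
  unfold coldExp; omega

section Defs

variable {G : Type} [Group G] [TopologicalSpace G] [IsTopologicalGroup G] [CompactSpace G]
  [MeasurableSpace G] [BorelSpace G]

/-- **Ratio datum** of the cold torus with spatial cross-section `N³`: ratios `rᵢ ∈ [0,1]` indexed by a type `ι` with a vacuum index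
`i₀`, `r_{i₀} = 1`, whose power sums off the vacuum are the trace excesses: `Σ_{i ≠ i₀} rᵢ^{m+2} = traceExcess ρ β N (m+2)` for all `m`.
The tree produces one from the transfer-matrix eigenbasis (`DoublingDefect.exists_ratios_hasSum_traceExcess`); any two ratio data have
the same non-zero values with multiplicity (power sums of all orders `≥ 2` agree), so statements quantified over ALL ratio data below
are statements about the spectrum. -/
def IsRatioDatum {n : ℕ} (ρ : G →* Matrix (Fin n) (Fin n) ℂ) (β : ℝ) (N : ℕ) [NeZero N]
    (ι : Type) [DecidableEq ι] (rr : ι → ℝ) (i₀ : ι) : Prop :=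
  (∀ i, 0 ≤ rr i ∧ rr i ≤ 1) ∧ rr i₀ = 1 ∧
    ∀ m : ℕ, HasSum (Function.update (fun i => rr i ^ (m + 2)) i₀ 0) (traceExcess ρ β N (m + 2))

/-- **The rank-`Q` tail** of a ratio datum at time extent `m + 2`, relative to a finite set `F` of removed («light») levels:
`traceExcess ρ β N (m+2) − Σ_{j ∈ F} r_j^{m+2}` — for `i₀ ∉ F` the total weight `Σ_{i ∉ F ∪ {i₀}} rᵢ^{m+2}` of the spectrum beyond
the vacuum and the removed levels (`hasSum_rankTail`).  `F = ∅` is the trace excess itself (rank 0 = the cold-pressure currency). -/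
def rankTail {n : ℕ} (ρ : G →* Matrix (Fin n) (Fin n) ℂ) (β : ℝ) (N : ℕ) [NeZero N]
    {ι : Type} (rr : ι → ℝ) (F : Finset ι) (m : ℕ) : ℝ :=
  traceExcess ρ β N (m + 2) - ∑ j ∈ F, rr j ^ (m + 2)

end Defs

/-! ## §2 The statements of LINE D -/

/-- **PXᴷ = `PinnedRankExit` (stub, THE NUMBERᴷ; non-simply-connected compact simple `G`).**  Under the crux's own hypotheses on the
floor scale `a` there is a light rank `Q` (physically `|π₁(G)|³ − 1`) such that for every tolerance `θ > 0` and every lattice floor `S₀`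
there are a pin `T` and a threshold `β₁` with: every `β ≥ β₁` has SOME cold symmetric torus `(2S+1)³ × (coldExp S + 2)`, `S ≥ S₀`,
of physical size `a(β)·(2S+1) ≤ T`, whose rank-`Q` tail is `≤ θ` (for every ratio datum, some `≤ Q` levels can be removed leaving
tail `≤ θ`).  The `π₁ ≠ 1` twin of `PinnedExit96.PinnedExitAt`; `∀ θ` (not `θ = 1/24`) because Rᴷ's constant is not known.
Why it might fail: it is confinement-at-the-floor-scale for the adjoint-type groups in contrapositive (no printed weak-coupling tool);
false if light levels beyond the flux multiplet accumulate at the floor scale. -/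
def PinnedRankExit : Prop :=
  ∀ (G : Type) [Group G] [TopologicalSpace G] [IsTopologicalGroup G] [CompactSpace G],
    IsCompactSimpleLieGroup G → ¬ SimplyConnectedSpace G →
    letI : MeasurableSpace G := borel G
    haveI : BorelSpace G := ⟨rfl⟩
    ∀ (r : LatticeRep G) (a : ℝ → ℝ), (∀ β, 0 < a β) → Tendsto a atTop (𝓝 0) → LowerBounds G r a →
      ∃ Q : ℕ, ∀ θ : ℝ, 0 < θ → ∀ S₀ : ℕ, ∃ T β₁ : ℝ, ∀ β : ℝ, β₁ ≤ β →
        ∃ S : ℕ, S₀ ≤ S ∧ a β * ((2 * S + 1 : ℕ) : ℝ) ≤ T ∧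
          ∀ (ι : Type) [DecidableEq ι] (rr : ι → ℝ) (i₀ : ι), IsRatioDatum r.ρ β (2 * S + 1) ι rr i₀ →
            ∃ F : Finset ι, i₀ ∉ F ∧ F.card ≤ Q ∧ rankTail r.ρ β (2 * S + 1) rr F (coldExp S) ≤ θ

/-- **Rᴷ = `RankTailSquaring` (stub, the INDUCTIVE STEP, BASIN FORM; non-simply-connected compact simple `G`, every rank `Q`).**
For every `r` and `Q` there are ONE constant `C`, a basin radius `η > 0`, a coupling threshold `β₀` and a lattice floor `S₀` such that
for `β ≥ β₀`, `S ≥ S₀` and every `S' ∈ [2S, 4S]`: whenever `≤ Q` removed levels leave `rankTail(S) ≤ η` at cross-section `2S+1`, some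
`≤ Q` levels can be removed at `2S'+1` with `rankTail(S') ≤ C · rankTail(S)²` (canonical cold shapes on both sides).  The premise
`≤ η` makes this the rank-`Q` analogue of the tree's basin shape `AbstractBasinRung*.AbstractBasin ε⋆ C` (nothing is claimed about boxes
that are not already `η`-pure modulo `Q`, in particular nothing about the femto ∕ hot corner where the trace excess is large); rank `0`
on simply-connected `G` is the PROVED sharp recursion `AspectBootstrap.coldDefect_sq_le_two_pow` in the cold-defect currency; rank
`Q ≥ 1` is NEW and OPEN: the abstract [Sym][TM][Vol] proof of rank 0 does not extend (its `extension_le` step is a total-trace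
inequality and loses `(S'/S − 1)·log(Q+1)` against a multiplet).  Why it might fail: a level that is light only in the bigger box — an
aspect-dependent flux energy crossing the removed set between `S` and `S'`, or levels accumulating at the floor scale — breaks one
`(C, η)` uniform in `β`; nothing rigorous supports it beyond rank 0, and a [Sym][TM][Vol] toy family with a planted multiplet may already
refute the abstract form. -/
def RankTailSquaring : Prop :=
  ∀ (G : Type) [Group G] [TopologicalSpace G] [IsTopologicalGroup G] [CompactSpace G],
    IsCompactSimpleLieGroup G → ¬ SimplyConnectedSpace G →
    letI : MeasurableSpace G := borel G
    haveI : BorelSpace G := ⟨rfl⟩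
    ∀ (r : LatticeRep G) (Q : ℕ), ∃ C η β₀ : ℝ, ∃ S₀ : ℕ, 0 < C ∧ 0 < η ∧ ∀ β : ℝ, β₀ ≤ β → ∀ S : ℕ, S₀ ≤ S →
      ∀ S' : ℕ, 2 * S ≤ S' → S' ≤ 4 * S →
        ∀ (ι : Type) [DecidableEq ι] (rr : ι → ℝ) (i₀ : ι), IsRatioDatum r.ρ β (2 * S + 1) ι rr i₀ →
          ∀ F : Finset ι, i₀ ∉ F → F.card ≤ Q → rankTail r.ρ β (2 * S + 1) rr F (coldExp S) ≤ η →
            ∀ (ι' : Type) [DecidableEq ι'] (rr' : ι' → ℝ) (i₀' : ι'), IsRatioDatum r.ρ β (2 * S' + 1) ι' rr' i₀' →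
              ∃ F' : Finset ι', i₀' ∉ F' ∧ F'.card ≤ Q ∧
                rankTail r.ρ β (2 * S' + 1) rr' F' (coldExp S') ≤ C * rankTail r.ρ β (2 * S + 1) rr F (coldExp S) ^ 2

/-- **S⁺ = `MultipletPinned` (the strengthened statement; PROVED below from PXᴷ ∧ Rᴷ).**  For non-simply-connected compact simple `G`,
under the crux's hypotheses on `a`: a light rank `Q`, a pin `T` and a threshold `β₂` such that every `β ≥ β₂` carries a length `ξ ≥ 1`
of at most `T` floor-lengths (`a β · ξ ≤ T`) with cold pressure modulo a light multiplet of rank `Q` at rate `1/ξ`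
(`FluxCodeBlindness.LightMultipletPressureAt r β Q (1/ξ)`: on EVERY cold symmetric torus beyond a threshold the trace excess minus
`≤ Q` light levels is `≤ C₀ (2S+1)³ e^{−(m+2)/ξ}`). -/
def MultipletPinned : Prop :=
  ∀ (G : Type) [Group G] [TopologicalSpace G] [IsTopologicalGroup G] [CompactSpace G],
    IsCompactSimpleLieGroup G → ¬ SimplyConnectedSpace G →
    letI : MeasurableSpace G := borel G
    haveI : BorelSpace G := ⟨rfl⟩
    ∀ (r : LatticeRep G) (a : ℝ → ℝ), (∀ β, 0 < a β) → Tendsto a atTop (𝓝 0) → LowerBounds G r a →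
      ∃ (Q : ℕ) (T β₂ : ℝ), ∀ β : ℝ, β₂ ≤ β →
        ∃ ξ : ℕ, 1 ≤ ξ ∧ a β * (ξ : ℝ) ≤ T ∧ LightMultipletPressureAt r β Q (1 / (ξ : ℝ))

/-- **BLINDᴷ = `BlindGivenMultiplet` (stub, XL — the flux-code property; non-simply-connected compact simple `G`).**  GIVEN cold
pressure modulo a pinned light multiplet (the W-currency of S⁺, for some rank, pin and threshold), the light levels form a CODE for the
local gauge-invariant observables: the light-code certificate of `FluxCodeBlindness` holds at a pinned light-code length — exactly the
hypotheses `hon`/`hpin` of the landed seam `gapInUnits_of_lightCode_pinned`.  Content: local indistinguishability of the 't Hooft flux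
vacua (sector-mean blindness, electric-flux superselection at width `wd A B`) — the code half of card ym19354-5's `I_code` in floor
units; the fixed-β located pieces are crux 16405's stubs EBLIND/SPLIT/EQUI.  Species-quantified by necessity
(`FluxCodeBlindness.abs_sectorMean_sub_mean_le`: blindness is necessary for clustering).
Why it might fail: it is the dynamical statement that NO quasi-local observable separates the flux sectors at weak coupling (no order
parameter for the magnetic ℤ_{|π₁|} one-form symmetry) — open; as typed it also asks for finite-dimensional light-code MODELS
approximating every lattice correlator, an extra approximation layer that may be mis-cut. -/
def BlindGivenMultiplet : Prop :=
  ∀ (G : Type) [Group G] [TopologicalSpace G] [IsTopologicalGroup G] [CompactSpace G],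
    IsCompactSimpleLieGroup G → ¬ SimplyConnectedSpace G →
    letI : MeasurableSpace G := borel G
    haveI : BorelSpace G := ⟨rfl⟩
    ∀ (r : LatticeRep G) (a : ℝ → ℝ), (∀ β, 0 < a β) →
      (∃ (Q : ℕ) (T β₂ : ℝ), ∀ β : ℝ, β₂ ≤ β →
        ∃ ξ : ℕ, 1 ≤ ξ ∧ a β * (ξ : ℝ) ≤ T ∧ LightMultipletPressureAt r β Q (1 / (ξ : ℝ))) →
      ∃ (Q : ℕ) (wd : YMSpecies G → YMSpecies G → ℕ) (ξ : ℝ → ℕ) (β₂ T : ℝ),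
        (∀ β : ℝ, β₂ ≤ β → 1 ≤ ξ β ∧ LightCodeCertificateAt r β Q (1 / (ξ β : ℝ)) wd) ∧
        (∀ β : ℝ, β₂ ≤ β → a β * (ξ β : ℝ) < T)

/-! ## §3 Rank-`Q` spectral bookkeeping (PROVED) -/

section Spectral

variable {G : Type} [Group G] [TopologicalSpace G] [IsTopologicalGroup G] [CompactSpace G]
  [MeasurableSpace G] [BorelSpace G]

/-- The tree's transfer-matrix eigen-data are a ratio datum (`exists_ratios_hasSum_traceExcess`). -/
theorem exists_ratioDatum [SecondCountableTopology G] (r : LatticeRep G) {β : ℝ} (hβ : 0 ≤ β) (N : ℕ) [NeZero N] :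
    ∃ (ι : Type) (_ : DecidableEq ι) (rr : ι → ℝ) (i₀ : ι), IsRatioDatum r.ρ β N ι rr i₀ := by
  obtain ⟨ι, hdec, rr, i₀, hr, h1, -, -, hx⟩ := exists_ratios_hasSum_traceExcess r.continuous r.mem_unitary hβ N
  exact ⟨ι, hdec, rr, i₀, hr, h1, hx⟩

variable {n : ℕ} {ρ : G →* Matrix (Fin n) (Fin n) ℂ} {β : ℝ} {N : ℕ} [NeZero N]
  {ι : Type} [DecidableEq ι] {rr : ι → ℝ} {i₀ : ι}

/-- **The rank-`Q` tail is the sum over the complement**: `Σ_{i ∉ insert i₀ F} rᵢ^{m+2} = rankTail … F m` for `i₀ ∉ F`. -/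
theorem hasSum_rankTail (hd : IsRatioDatum ρ β N ι rr i₀) {F : Finset ι} (hF : i₀ ∉ F) (m : ℕ) :
    HasSum (fun i => if i ∈ insert i₀ F then (0 : ℝ) else rr i ^ (m + 2)) (rankTail ρ β N rr F m) := by
  have h1 := hd.2.2 m
  have h2 : HasSum (fun i => if i ∈ F then rr i ^ (m + 2) else 0) (∑ j ∈ F, rr j ^ (m + 2)) := by
    have h : HasSum (fun i => if i ∈ F then rr i ^ (m + 2) else 0)
        (∑ b ∈ F, (if b ∈ F then rr b ^ (m + 2) else 0)) :=
      hasSum_sum_of_ne_finset_zero (fun b hb => if_neg hb)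
    have hs : ∑ b ∈ F, (if b ∈ F then rr b ^ (m + 2) else 0) = ∑ j ∈ F, rr j ^ (m + 2) :=
      Finset.sum_congr rfl fun j hj => if_pos hj
    rw [hs] at h
    exact h
  have h3 := h1.sub h2
  have hfun : (fun i => if i ∈ insert i₀ F then (0 : ℝ) else rr i ^ (m + 2)) =
      (fun b => Function.update (fun i => rr i ^ (m + 2)) i₀ 0 b - if b ∈ F then rr b ^ (m + 2) else 0) := by
    funext i
    rcases eq_or_ne i i₀ with rfl | hne
    · simp [hF]
    · rw [Function.update_of_ne hne]
      by_cases hi : i ∈ F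
      · simp [hi]
      · simp [hi, hne]
  rw [hfun]
  unfold rankTail
  exact h3

/-- The rank-`Q` tail is non-negative (for `i₀ ∉ F`). -/
theorem rankTail_nonneg (hd : IsRatioDatum ρ β N ι rr i₀) {F : Finset ι} (hF : i₀ ∉ F) (m : ℕ) :
    0 ≤ rankTail ρ β N rr F m := by
  refine (hasSum_rankTail hd hF m).nonneg fun i => ?_
  split_ifs
  · exact le_rfl
  · exact pow_nonneg (hd.1 i).1 _

/-- **Rank-`Q` propagation in the time extent** (the rank-`Q` twin of `DoublingDefect.traceExcess_le_exp_of_le`): if the tail beyond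
`F` is `≤ e^{−c(m+2)}` at extent `m + 2`, then it is `≤ e^{−c(k+2)}` at every extent `k + 2 ≥ m + 2` — each remaining ratio is at
most `e^{−c}` (one term ≤ the sum), and the `(k+2)`-tail is termwise `≤ e^{−c(k−m)}` times the `(m+2)`-tail. -/
theorem rankTail_le_exp_of_le (hd : IsRatioDatum ρ β N ι rr i₀) {F : Finset ι} (hF : i₀ ∉ F) {m k : ℕ} (hmk : m ≤ k)
    {c : ℝ} (h₀ : rankTail ρ β N rr F m ≤ Real.exp (-(c * ((m + 2 : ℕ) : ℝ)))) :
    rankTail ρ β N rr F k ≤ Real.exp (-(c * ((k + 2 : ℕ) : ℝ))) := by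
  have hx₀ := hasSum_rankTail hd hF m
  have hxk := hasSum_rankTail hd hF k
  set q : ℝ := Real.exp (-c) with hq
  have hq0 : 0 ≤ q := (Real.exp_pos _).le
  have hexp : ∀ j : ℕ, Real.exp (-(c * (j : ℝ))) = q ^ j := fun j => by
    rw [hq, ← Real.exp_nat_mul]; ring_nf
  rw [hexp (m + 2)] at h₀
  rw [hexp (k + 2)]
  have hg0 : ∀ i, 0 ≤ (if i ∈ insert i₀ F then (0 : ℝ) else rr i ^ (m + 2)) := fun i => by
    split_ifs
    · exact le_rfl
    · exact pow_nonneg (hd.1 i).1 _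
  -- each remaining ratio is `≤ q`
  have hri : ∀ i, i ∉ insert i₀ F → rr i ≤ q := fun i hi => by
    have h1 : rr i ^ (m + 2) ≤ rankTail ρ β N rr F m := by
      have h := le_hasSum hx₀ i fun j _ => hg0 j
      rwa [if_neg hi] at h
    exact (pow_le_pow_iff_left₀ (hd.1 i).1 hq0 (by omega : m + 2 ≠ 0)).1 (h1.trans h₀)
  have hcmp : ∀ i, (if i ∈ insert i₀ F then (0 : ℝ) else rr i ^ (k + 2)) ≤
      q ^ (k - m) * (if i ∈ insert i₀ F then (0 : ℝ) else rr i ^ (m + 2)) := fun i => by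
    by_cases hi : i ∈ insert i₀ F
    · simp [hi]
    · rw [if_neg hi, if_neg hi]
      have hsplit : rr i ^ (k + 2) = rr i ^ (k - m) * rr i ^ (m + 2) := by
        rw [← pow_add]; congr 1; omega
      rw [hsplit]
      exact mul_le_mul_of_nonneg_right (pow_le_pow_left₀ (hd.1 i).1 (hri i hi) _) (pow_nonneg (hd.1 i).1 _)
  have hsum := hasSum_le hcmp hxk (hx₀.mul_left (q ^ (k - m)))
  calc rankTail ρ β N rr F k ≤ q ^ (k - m) * rankTail ρ β N rr F m := hsum
    _ ≤ q ^ (k - m) * q ^ (m + 2) := mul_le_mul_of_nonneg_left h₀ (pow_nonneg hq0 _)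
    _ = q ^ (k + 2) := by rw [← pow_add]; congr 1; omega

omit [NeZero N] [DecidableEq ι] in
/-- Padding: `≤ Q` removed levels give a light vector `θ : Fin Q → [0,1]` with the same power sums (zeros appended). -/
theorem exists_fin_pad (hr : ∀ i, 0 ≤ rr i ∧ rr i ≤ 1) (F : Finset ι) {Q : ℕ} (hQ : F.card ≤ Q) :
    ∃ θ : Fin Q → ℝ, (∀ k, 0 ≤ θ k ∧ θ k ≤ 1) ∧ ∀ p : ℕ, ∑ k, θ k ^ (p + 2) = ∑ j ∈ F, rr j ^ (p + 2) := by
  obtain ⟨d, rfl⟩ := Nat.exists_eq_add_of_le hQ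
  refine ⟨Fin.append (fun k : Fin F.card => rr (F.equivFin.symm k)) (fun _ : Fin d => (0 : ℝ)),
    fun k => ?_, fun p => ?_⟩
  · induction k using Fin.addCases with
    | left i => simpa using hr _
    | right j => simp
  · rw [Fin.sum_univ_add]
    simp only [Fin.append_left, Fin.append_right]
    rw [zero_pow (by omega : p + 2 ≠ 0), Finset.sum_const_zero, add_zero,
      ← Finset.sum_coe_sort F (fun j => rr j ^ (p + 2))]
    exact F.equivFin.symm.sum_comp (fun x => rr (x : ι) ^ (p + 2))


/-- **The time-doubling half of Rᴷ is a theorem at every rank** (rung).  For the SAME torus and the same excused set, doubling the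
time exponent squares the rank-`Q` tail: `rankTail(2m+2) ≤ rankTail(m)²` (i.e. exponent `m+2 ↦ 2(m+2)`; `Σ aᵢ² ≤ (Σ aᵢ)²` on the
complement of `insert i₀ F`).  Hence the OPEN content of Rᴷ is entirely the SPATIAL growth `2S+1 ↦ 2S'+1` of the cross-section. -/
theorem rankTail_double_le_sq (hd : IsRatioDatum ρ β N ι rr i₀) {F : Finset ι} (hF : i₀ ∉ F) (m : ℕ) :
    rankTail ρ β N rr F (2 * m + 2) ≤ rankTail ρ β N rr F m ^ 2 := by
  have hT := hasSum_rankTail hd hF m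
  have h2 := hasSum_rankTail hd hF (2 * m + 2)
  have hnn : ∀ i, 0 ≤ (if i ∈ insert i₀ F then (0 : ℝ) else rr i ^ (m + 2)) := fun i => by
    split_ifs
    · exact le_rfl
    · exact pow_nonneg (hd.1 i).1 _
  have hle : ∀ i, (if i ∈ insert i₀ F then (0 : ℝ) else rr i ^ (m + 2)) ≤ rankTail ρ β N rr F m := fun i =>
    le_hasSum hT i (fun j _ => hnn j)
  have hmul := hT.mul_right (rankTail ρ β N rr F m)
  have key : ∀ i, (if i ∈ insert i₀ F then (0 : ℝ) else rr i ^ (2 * m + 2 + 2)) ≤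
      (if i ∈ insert i₀ F then (0 : ℝ) else rr i ^ (m + 2)) * rankTail ρ β N rr F m := fun i => by
    by_cases h : i ∈ insert i₀ F
    · simp [h]
    · have hpow : rr i ^ (2 * m + 2 + 2) = rr i ^ (m + 2) * rr i ^ (m + 2) := by
        rw [← pow_add]; ring_nf
      have hi : rr i ^ (m + 2) ≤ rankTail ρ β N rr F m := by simpa [h] using hle i
      simpa [h, hpow] using mul_le_mul_of_nonneg_left hi (pow_nonneg (hd.1 i).1 (m + 2))
  have := hasSum_le key h2 hmul
  simpa [sq] using this

end Spectral

/-! ## §4 The infimum of achievable tail bounds and its recursion (PROVED) -/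

section Achievable

variable {G : Type} [Group G] [TopologicalSpace G] [IsTopologicalGroup G] [CompactSpace G]
  [MeasurableSpace G] [BorelSpace G]

/-- Achievable rank-`Q` tail bounds at cross-section `2S+1` (canonical cold shape): reals `x` such that EVERY ratio datum admits
`≤ Q` removed levels with tail `≤ x` — the datum-free shape in which PXᴷ and Rᴷ speak. -/
def achievable (r : LatticeRep G) (β : ℝ) (Q S : ℕ) : Set ℝ :=
  {x | ∀ (ι : Type) [DecidableEq ι] (rr : ι → ℝ) (i₀ : ι), IsRatioDatum r.ρ β (2 * S + 1) ι rr i₀ →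
    ∃ F : Finset ι, i₀ ∉ F ∧ F.card ≤ Q ∧ rankTail r.ρ β (2 * S + 1) rr F (coldExp S) ≤ x}

/-- The optimal rank-`Q` tail `δ_Q(β, S) := inf achievable` — the inductive quantity of LINE D. -/
def infTail (r : LatticeRep G) (β : ℝ) (Q S : ℕ) : ℝ :=
  sInf (achievable r β Q S)

variable (r : LatticeRep G) (β : ℝ) (Q S : ℕ)

theorem traceExcess_mem_achievable :
    traceExcess r.ρ β (2 * S + 1) (coldExp S + 2) ∈ achievable r β Q S :=
  fun ι _ rr i₀ _ => ⟨∅, by simp, by simp, by simp [rankTail]⟩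

theorem achievable_nonempty : (achievable r β Q S).Nonempty :=
  ⟨_, traceExcess_mem_achievable r β Q S⟩

variable {r β Q S}

theorem mem_achievable_of_le {x y : ℝ} (hx : x ∈ achievable r β Q S) (hxy : x ≤ y) : y ∈ achievable r β Q S :=
  fun ι _ rr i₀ hd => by
    obtain ⟨F, hF, hc, hle⟩ := hx ι rr i₀ hd
    exact ⟨F, hF, hc, hle.trans hxy⟩

theorem nonneg_of_mem_achievable [SecondCountableTopology G] (hβ : 0 ≤ β) {x : ℝ} (hx : x ∈ achievable r β Q S) :
    0 ≤ x := by
  obtain ⟨ι, hdec, rr, i₀, hd⟩ := exists_ratioDatum r hβ (2 * S + 1)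
  obtain ⟨F, hF, -, hle⟩ := hx ι rr i₀ hd
  exact (rankTail_nonneg hd hF _).trans hle

theorem infTail_nonneg [SecondCountableTopology G] (hβ : 0 ≤ β) : 0 ≤ infTail r β Q S :=
  le_csInf (achievable_nonempty r β Q S) fun _ hx => nonneg_of_mem_achievable hβ hx

theorem infTail_le_of_mem [SecondCountableTopology G] (hβ : 0 ≤ β) {x : ℝ} (hx : x ∈ achievable r β Q S) :
    infTail r β Q S ≤ x :=
  csInf_le ⟨0, fun _ hy => nonneg_of_mem_achievable hβ hy⟩ hx

theorem mem_achievable_of_infTail_lt {x : ℝ} (h : infTail r β Q S < x) : x ∈ achievable r β Q S := by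
  obtain ⟨y, hy, hyx⟩ := exists_lt_of_csInf_lt (achievable_nonempty r β Q S) h
  exact mem_achievable_of_le hy hyx.le

/-- **The recursion passes to the infimum** (basin form): if `δ_Q(S) < η`, Rᴷ's clause at `(β, S, S')` gives
`δ_Q(S') ≤ C · δ_Q(S)²`. -/
theorem infTail_recursion [SecondCountableTopology G] (hβ : 0 ≤ β) {C η : ℝ} (hC : 0 ≤ C) {S' : ℕ}
    (hlt : infTail r β Q S < η)
    (hRK : ∀ (ι : Type) [DecidableEq ι] (rr : ι → ℝ) (i₀ : ι), IsRatioDatum r.ρ β (2 * S + 1) ι rr i₀ →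
      ∀ F : Finset ι, i₀ ∉ F → F.card ≤ Q → rankTail r.ρ β (2 * S + 1) rr F (coldExp S) ≤ η →
        ∀ (ι' : Type) [DecidableEq ι'] (rr' : ι' → ℝ) (i₀' : ι'), IsRatioDatum r.ρ β (2 * S' + 1) ι' rr' i₀' →
          ∃ F' : Finset ι', i₀' ∉ F' ∧ F'.card ≤ Q ∧
            rankTail r.ρ β (2 * S' + 1) rr' F' (coldExp S') ≤ C * rankTail r.ρ β (2 * S + 1) rr F (coldExp S) ^ 2) :
    infTail r β Q S' ≤ C * infTail r β Q S ^ 2 := by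
  have key : ∀ ε : ℝ, 0 < ε → infTail r β Q S + ε < η → infTail r β Q S' ≤ C * (infTail r β Q S + ε) ^ 2 := by
    intro ε hε hεη
    have hx : infTail r β Q S + ε ∈ achievable r β Q S := mem_achievable_of_infTail_lt (by linarith)
    refine infTail_le_of_mem hβ fun ι' _ rr' i₀' hd' => ?_
    obtain ⟨ι, hdec, rr, i₀, hd⟩ := exists_ratioDatum r hβ (2 * S + 1)
    obtain ⟨F, hF, hcard, hle⟩ := hx ι rr i₀ hd
    obtain ⟨F', hF', hcard', hle'⟩ := hRK ι rr i₀ hd F hF hcard (hle.trans hεη.le) ι' rr' i₀' hd'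
    refine ⟨F', hF', hcard', hle'.trans ?_⟩
    have h0 : 0 ≤ rankTail r.ρ β (2 * S + 1) rr F (coldExp S) := rankTail_nonneg hd hF _
    exact mul_le_mul_of_nonneg_left (pow_le_pow_left₀ h0 hle 2) hC
  have ht : Tendsto (fun ε : ℝ => C * (infTail r β Q S + ε) ^ 2) (𝓝[>] 0)
      (𝓝 (C * (infTail r β Q S + 0) ^ 2)) :=
    ((continuous_const.mul ((continuous_const.add continuous_id).pow 2)).tendsto 0).mono_left
      nhdsWithin_le_nhds
  rw [add_zero] at ht
  have hev : ∀ᶠ ε in 𝓝[>] (0 : ℝ), infTail r β Q S' ≤ C * (infTail r β Q S + ε) ^ 2 := by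
    have hmem : Set.Ioo (0 : ℝ) (η - infTail r β Q S) ∈ 𝓝[>] (0 : ℝ) := Ioo_mem_nhdsGT (by linarith)
    filter_upwards [hmem] with ε hε
    exact key ε hε.1 (by linarith [hε.2])
  exact ge_of_tendsto ht hev

end Achievable

/-! ## §5 THE SEAM (PROVED): PXᴷ ∧ Rᴷ ⇒ S⁺ -/

/-- **PXᴷ ∧ Rᴷ ⇒ `MultipletPinned`.**  Per `(G, r, a)`: PXᴷ gives the rank `Q`; Rᴷ at `Q` gives `(C, β₀, S₀)`; PXᴷ at the basin
tolerance `1/(16·max C 2)` and floor `max S₀ 1` gives `(T, β₁)`.  For `β ≥ max β₀ β₁ 0` the pinned box `S⋆` has `δ_Q(S⋆) ≤ 1/(16 C')`,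
the infimum recursion holds on `[S₀, ∞)`, so `DoublingDefect.defect_decay_of_recursion` gives `δ_Q(S') ≤ C'⁻¹ e^{−(S'+1)/S⋆}` for all
`S' ≥ 2S⋆`; at each such `S'` some `≤ Q` removed levels leave tail `≤ e^{−(coldExp S' + 2)/S⋆}` at the canonical cold shape, hence
(`rankTail_le_exp_of_le`) `≤ e^{−(m+2)/S⋆}` at every cold extent, and padding gives `LightMultipletPressureAt r β Q (1/S⋆)` with
`C₀ = 1`; the pin is `a β · S⋆ ≤ a β · (2S⋆+1) ≤ T`. -/
theorem multipletPinned_of_exit_squaring (hP : PinnedRankExit) (hR : RankTailSquaring) : MultipletPinned := by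
  intro G _ _ _ _ hG hnsc
  letI : MeasurableSpace G := borel G
  haveI : BorelSpace G := ⟨rfl⟩
  intro r a ha ha0 hlb
  haveI : SecondCountableTopology G :=
    (r.continuous.isClosedEmbedding r.injective).isEmbedding.secondCountableTopology
  obtain ⟨Q, hQ⟩ := hP G hG hnsc r a ha ha0 hlb
  obtain ⟨C, η, β₀, S₀, hC, hη, hrec⟩ := hR G hG hnsc r Q
  set C' : ℝ := max C (max 2 (1 / η)) with hC'def
  have hCC' : C ≤ C' := le_max_left _ _
  have hC'2 : 2 ≤ C' := (le_max_left _ _).trans (le_max_right _ _)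
  have hC'η : 1 / η ≤ C' := (le_max_right _ _).trans (le_max_right _ _)
  have hC' : 0 < C' := lt_of_lt_of_le hC hCC'
  have hC'inv : C'⁻¹ ≤ η := by
    have h := inv_anti₀ (one_div_pos.2 hη) hC'η
    rwa [one_div, inv_inv] at h
  have hηC' : η ≤ C' * η ^ 2 := by
    -- `η = (1/η) · η² ≤ C' · η²`
    have : (1 / η) * η ^ 2 = η := by field_simp
    nlinarith [mul_le_mul_of_nonneg_right hC'η (sq_nonneg η)]
  obtain ⟨T, β₁, hpx⟩ := hQ (1 / (16 * C')) (by positivity) (max S₀ 1)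
  refine ⟨Q, T, max β₀ (max β₁ 0), fun β hβ => ?_⟩
  have hββ₀ : β₀ ≤ β := le_trans (le_max_left _ _) hβ
  have hββ₁ : β₁ ≤ β := le_trans ((le_max_left _ _).trans (le_max_right _ _)) hβ
  have hβ0 : (0 : ℝ) ≤ β := le_trans ((le_max_right _ _).trans (le_max_right _ _)) hβ
  obtain ⟨Ss, hSs, hpin, hFex⟩ := hpx β hββ₁
  have hSs0 : S₀ ≤ Ss := le_trans (le_max_left _ _) hSs
  have hSs1 : 1 ≤ Ss := le_trans (le_max_right _ _) hSs
  -- the inductive quantity at this `β`: the achievable-tail infimum, capped at the basin radius `η`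
  set δ : ℕ → ℝ := fun S => min (infTail r β Q S) η with hδ
  have hrec' : ∀ S : ℕ, S₀ ≤ S → ∀ S' : ℕ, 2 * S ≤ S' → S' ≤ 4 * S → δ S' ≤ C' * δ S ^ 2 := by
    intro S hS S' h2 h4
    by_cases hin : infTail r β Q S < η
    · -- inside the basin: Rᴷ fires
      have h := infTail_recursion (r := r) (Q := Q) (S := S) hβ0 hC.le (S' := S') hin
        (fun ι _ rr i₀ hd F hF hc hFη ι' _ rr' i₀' hd' =>
          hrec β hββ₀ S hS S' h2 h4 ι rr i₀ hd F hF hc hFη ι' rr' i₀' hd')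
      have hδS : δ S = infTail r β Q S := min_eq_left hin.le
      rw [hδS]
      exact (min_le_left _ _).trans (h.trans (mul_le_mul_of_nonneg_right hCC' (sq_nonneg _)))
    · -- outside the basin the capped quantity is `η ≤ C' η²`
      have hδS : δ S = η := min_eq_right (not_lt.1 hin)
      rw [hδS]
      exact (min_le_right _ _).trans hηC'
  have hnn : ∀ S : ℕ, S₀ ≤ S → 0 ≤ δ S := fun S _ => le_min (infTail_nonneg hβ0) hη.le
  have hex : δ Ss ≤ 1 / (16 * C') :=
    (min_le_left _ _).trans (infTail_le_of_mem hβ0 fun ι _ rr i₀ hd => hFex ι rr i₀ hd)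
  have hdec := defect_decay_of_recursion (δ := δ) hC' hrec' hnn hSs0 hSs1 hex
  have hSsR : (0 : ℝ) < Ss := by exact_mod_cast (by omega : 0 < Ss)
  refine ⟨Ss, hSs1, ?_, ?_⟩
  · -- the pin `a β · S⋆ ≤ a β · (2 S⋆ + 1) ≤ T`
    have h1 : (Ss : ℝ) ≤ ((2 * Ss + 1 : ℕ) : ℝ) := by exact_mod_cast (by omega : Ss ≤ 2 * Ss + 1)
    exact (mul_le_mul_of_nonneg_left h1 (ha β).le).trans hpin
  · -- `LightMultipletPressureAt r β Q (1 / S⋆)` with `C₀ = 1`, threshold `2 S⋆`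
    refine ⟨1, zero_le_one, 2 * Ss, fun S' hS' => ?_⟩
    -- some `≤ Q` removed levels at `S'` leave tail `≤ e^{−(S'+1)/S⋆}`
    have hδS' := hdec S' hS'
    have hpos : 0 < C'⁻¹ * Real.exp (-(((S' : ℝ) + 1) / Ss)) := mul_pos (inv_pos.2 hC') (Real.exp_pos _)
    -- the decayed cap is `< η`, so the minimum is the infimum itself
    have hexp1 : Real.exp (-(((S' : ℝ) + 1) / Ss)) < 1 :=
      Real.exp_lt_one_iff.2 (by
        have : (0 : ℝ) < ((S' : ℝ) + 1) / Ss := by positivity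
        linarith)
    have hδη : δ S' < η :=
      lt_of_le_of_lt hδS' (lt_of_lt_of_le (by nlinarith [inv_pos.2 hC']) hC'inv)
    have hinf : infTail r β Q S' < η := by
      rcases min_lt_iff.1 hδη with h | h
      · exact h
      · exact absurd h (lt_irrefl _)
    have hδeq : δ S' = infTail r β Q S' := min_eq_left hinf.le
    rw [hδeq] at hδS'
    have hlt : infTail r β Q S' < 2 * (C'⁻¹ * Real.exp (-(((S' : ℝ) + 1) / Ss))) := by linarith
    have hmem : 2 * (C'⁻¹ * Real.exp (-(((S' : ℝ) + 1) / Ss))) ∈ achievable r β Q S' :=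
      mem_achievable_of_infTail_lt hlt
    obtain ⟨ι, hdecι, rr, i₀, hd⟩ := exists_ratioDatum r hβ0 (2 * S' + 1)
    obtain ⟨F, hF, hcard, hle⟩ := hmem ι rr i₀ hd
    -- `2 C'⁻¹ e^{−(S'+1)/S⋆} ≤ e^{−(1/S⋆)(coldExp S' + 2)}`
    have h2C : 2 * C'⁻¹ ≤ 1 := by
      rw [inv_eq_one_div]
      have := one_div_le_one_div_of_le two_pos hC'2
      linarith
    have hbase : rankTail r.ρ β (2 * S' + 1) rr F (coldExp S') ≤
        Real.exp (-(1 / (Ss : ℝ) * ((coldExp S' + 2 : ℕ) : ℝ))) := by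
      refine hle.trans ?_
      rw [← mul_assoc]
      refine (mul_le_of_le_one_left (Real.exp_pos _).le h2C).trans (Real.exp_le_exp.2 ?_)
      rw [neg_le_neg_iff, one_div_mul_eq_div, div_le_div_iff_of_pos_right hSsR]
      have h : 2 * (coldExp S' + 2) ≤ S' + 4 := coldExp_add_two_le S'
      have h' : ((coldExp S' + 2 : ℕ) : ℝ) ≤ (S' : ℝ) + 1 := by
        have : coldExp S' + 2 ≤ S' + 1 := by omega
        exact_mod_cast this
      exact h'
    obtain ⟨θ, hθ, hθsum⟩ := exists_fin_pad hd.1 F hcard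
    refine ⟨θ, hθ, fun m hm => ?_⟩
    have hmk : coldExp S' ≤ m := coldExp_le hm
    have hprop := rankTail_le_exp_of_le hd hF hmk hbase
    rw [hθsum m]
    refine (le_of_eq_of_le rfl hprop).trans ?_
    have hV : (1 : ℝ) ≤ 1 * ((2 * S' + 1 : ℕ) : ℝ) ^ 3 := by
      rw [one_mul]
      exact one_le_pow₀ (by exact_mod_cast (by omega : 1 ≤ 2 * S' + 1))
    exact le_mul_of_one_le_left (Real.exp_pos _).le hV

/-! ## §6 Compositions BY NAME -/

/-- **S⁺ ∧ BLINDᴷ ⇒ `IRnsc`** (REAL proof): per non-simply-connected `(G, r, a)`, BLINDᴷ turns the pinned multiplet into the pinned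
light-code certificate, and the landed `FluxCodeBlindness.gapInUnits_of_lightCode_pinned` concludes `GapInUnits G r a`. -/
theorem irnsc_of_multipletPinned (hW : MultipletPinned) (hB : BlindGivenMultiplet) : IRnsc := by
  intro G _ _ _ _ hG hnsc
  letI : MeasurableSpace G := borel G
  haveI : BorelSpace G := ⟨rfl⟩
  intro r a ha ha0 hlb
  obtain ⟨Q, T, β₂, hWβ⟩ := hW G hG hnsc r a ha ha0 hlb
  obtain ⟨Q', wd, ξ, β₂', T', hon, hpin⟩ := hB G hG hnsc r a ha ⟨Q, T, β₂, hWβ⟩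
  exact gapInUnits_of_lightCode_pinned r a ha ha0 hon hpin

/-- **PXᴷ ∧ Rᴷ ∧ BLINDᴷ ⇒ `IRnsc`** — LINE D's bill for the residual token, PROVED modulo its three stubs. -/
theorem irnsc_of_rankPurity (hP : PinnedRankExit) (hR : RankTailSquaring) (hB : BlindGivenMultiplet) : IRnsc :=
  irnsc_of_multipletPinned (multipletPinned_of_exit_squaring hP hR) hB

/-! ## §7 Registered stubs and the concluding composition -/

/-- stub PX (shared with the slot of record `Lines/pinned_exit_96_bill.lean`): one 96 %-pure cold `4:1` box per weak coupling in
floor units, simply-connected `G`. -/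
theorem stub_pinnedExit96 : PinnedExit96.PinnedExitAt (1 / 24) := by
  sorry

/-- stub PXᴷ (THE NUMBERᴷ, `π₁ ≠ 1`): one rank-`Q`-pure cold box per weak coupling in floor units. -/
theorem stub_pinnedRankExit : PinnedRankExit := by
  sorry

/-- stub Rᴷ (the inductive step): rank-`Q` tail squaring under spatial doubling, one constant. -/
theorem stub_rankTailSquaring : RankTailSquaring := by
  sorry

/-- stub BLINDᴷ (the flux code): pinned light multiplet ⇒ pinned light-code certificate. -/
theorem stub_blindGivenMultiplet : BlindGivenMultiplet := by
  sorry

/-- **The composition (REAL proof): PX → PXᴷ → Rᴷ → BLINDᴷ → `BalabanLadder.IR`**, by `PinnedExit96.IR_of` (simply-connected half)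
and `irnsc_of_rankPurity` (non-simply-connected half). -/
theorem IR_of (hPX : PinnedExit96.PinnedExitAt (1 / 24)) (hP : PinnedRankExit) (hR : RankTailSquaring)
    (hB : BlindGivenMultiplet) : Summit.QuantumFields.YangMills.Theses.BalabanLadder.IR :=
  PinnedExit96.IR_of hPX (irnsc_of_rankPurity hP hR hB)

/-- The crux from the registered stubs. -/
theorem IR_of_stubs : Summit.QuantumFields.YangMills.Theses.BalabanLadder.IR :=
  IR_of stub_pinnedExit96 stub_pinnedRankExit stub_rankTailSquaring stub_blindGivenMultiplet

/-! ## §8 Both ids (director-ym №27 (1)): the line also concludes the COFINAL item `IRcof` (stmt-QuantumFields-26930) BY NAME -/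

open Summit.QuantumFields.YangMills.Cruxes.OSLegsAtWeakCouplingC.Y2Bridge (gapOn_univ_of_gapInUnits) in
/-- `IR → IRcof` (take all couplings; same six lines as `Lines/cofinal_leaf.lean` ∕ `Lines/floor_handshake_cofinal.lean`, repeated here so
that this workfile imports no other workfile). -/
theorem IRcof_of_IR (h : Summit.QuantumFields.YangMills.Theses.BalabanLadder.IR) :
    Summit.QuantumFields.YangMills.Theses.BalabanLadder.IRcof := by
  intro G _ _ _ _ hG
  letI : MeasurableSpace G := borel G
  haveI : BorelSpace G := ⟨rfl⟩
  intro r a ha ha0 hlb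
  exact ⟨Set.univ, fun x => ⟨x, Set.mem_univ _, le_rfl⟩, gapOn_univ_of_gapInUnits r a (h G hG r a ha ha0 hlb)⟩

/-- **The registered stubs conclude the cofinal item of record BY NAME** (`Theses.BalabanLadder.IRcof`, stmt-QuantumFields-26930). -/
theorem IRcof_of_stubs : Summit.QuantumFields.YangMills.Theses.BalabanLadder.IRcof :=
  IRcof_of_IR IR_of_stubs


end Summit.QuantumFields.YangMills.Cruxes.IR.RankPurity

end
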